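import Summits.QuantumFields.YangMills.Theorems.FluctuationComparisonRegPrIntLOrganTangentFibreMeanVersionMW
import Summits.QuantumFields.YangMills.Theorems.FluctuationComparisonRegPrIntLOrganTangentAPackageDescendTo
import Literature.MathematicalPhysics.QuantumFieldTheory.Balaban1983to89.BalabanAdmissibleClassParams
import Literature.MathematicalPhysics.QuantumFieldTheory.Balaban1983to89.T4AveragingDisintegration
import Literature.MathematicalPhysics.QuantumFieldTheory.Balaban1983to89.T4CubeChartExp
import HarnessLib

/-!
# «SPREAD-FIBRE-LAW-H» v0.3m — THE FROZEN LIN EDITION (LEAD w3 g26 DESIGN CALL №32 ∕ ★★OWNER RULING №73 «TN-FREEZE-BY-EXCISION», 2026-08-31): v0.3k 167cd358eb8c3756 with the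
# LAW HALF EXCISED as unconsumed — conjuncts [13]–[23] of `SpreadFibreLawH` (the per-stride `D R₁ R₂ R₂₁ R₂₂` letters with their sign∕profile conjuncts and the final
# `∀ t, TailClause ∧ CovClause ∧ Resp1Clause ∧ Resp2Clause ∧ Cum2Resp1Clause ∧ Cum2Resp2Clause` conjunct), the head letters `rF ND N1 N2 N21 N22 ηin` with their conjuncts, and the seven
# clause defs of the former §2 are DELETED; `mwCut`∕`wNum`∕`wgt`, the chart block [0]–[11] (incl. `π`) and the (H) block [12] are BYTE-EQUAL to v0.3k; nothing else in the CODE moved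
# (this header paragraph and the `SpreadFibreLawH` docstring are the only non-deletions).  The LIN knit (`LinKnit_LEAD_w3g25.lean`) consumes exactly chart + (H) and is re-verified
# sorry-free on this text (LEAD g26, kernel rc 0, obtain-components lost only).  Jensen-side clauses (px5 g19 docking list a6079895: (JV1-h)…(JV4-h)) live in the SEPARATE superset
# row `SpreadFibreLawHJ` (workfile `FibreLawHJ.lean`, to come); the generic (S)(L0)(L1)(L2)(L21)(L22) clauses are retired (no consumer).  Below: the v0.3k provenance text, kept verbatim.
#
# (v0.3k provenance) «SPREAD-FIBRE-LAW-H» v0.3k (= v0.3j d73d5598 + LEAD №29 «INT-CONCL»: in (JT-h)∕(L1ʲ-h)∕(L2ʲ-h) the four `Integrable … τ` binders are CONCLUSIONS (`∧`), not hypotheses (`→`) — the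
discharger, who builds `Φ` WITH square stability [Balaban1985Variational Thm 1], owns them; v0.3j = v0.3i 3d78bc70 text + LEAD №27 docstrings D-1∕D-2; LEAD DESIGN DECISION №27:
edition (B′) GO; desk RULING №71) = v0.2 with the three joint clauses PINNED to the test functional `h_Ts := log ρ_Ts − log ρ′_Ts`, NO gradient letter, and the pull-back clause INTEGRATED against the fibre law (ideator ym-r3-idea-1 g28 — the pen named by LEAD w3 g25 №9/№11/№14/№20/№23) — ELABORATION CHECK ONLY, not a row of record.
# `SpreadFibreLawH` = JOINT-TRANSPORT-H ∧ JOINT-RESPONSE-H ∧ FIBRE-LAW-H on ONE shared fibred chart (V18 LIN KNIT SPEC w3g25 §2–§3/§6.4–§6.5, LEAD №20 DESIGN CALL, №23 DOCKING LIST).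

PROVENANCE / WHAT MOVED v0.1 → v0.2.
 • FRAME = O1ᵘ-H v2.1 VERBATIM through block ⑧ (the 14 inlined (β) sites at the v18.1 base window `(49 / 50 * θBal F.L γ b₀ p₀ j)`, NO seed clause),
   with ONE head binder added: `∃ pW, … pW ≤ p₀ →` (registered `BackwardStabilityFinSupH` spelling) — TN-TAIL-P0 (ideator №8 (c)): every SUB-window
   smallness clause below (`θBal_Ts∕8` tails, `θBal_Ts∕4` corners) is eventually super-polynomial only for `p₀ > 1∕2`; at `p₀ = 1∕2` the v0.1 text (∀ p₀ > 0)
   was refutable in principle while the frame's input tails still beat floor¹.  LIN′/JEN′/O1ᵘ-H v2.1 carry no `pW` today — a v18.2 text item for LEAD/desk.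
 • CHART BLOCK = ✓(L15-MW) `exists_height_fibredChart_descendTo`'s letters with `K ↦ Ts` (LEAD draft efd81821c3bb byte-for-byte: `Z τ Φ J S`, the tower
   small-field set `S`, section identity, disintegration on `descendTo⁻¹ A ∩ S`, continuity, `J ≤ CJ`, positivity of the good-set `J`-mass) + NEW: a BLOCK
   PROJECTION `π : Site_{Ts} → Site_j` (distance-contracting, fibres of `≤ (L^{Ts−j})³` sites — the level-`j` unit in which every rate below is measured,
   instr1 g14 TN-L0-SCALE (R1)/(T3)) (the v0.2/v0.3h SQUARE-STABILITY clause (SQ) is GONE in v0.3i: nothing consumes it once (JT-h) is integrated).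
 • DISPLACEMENT BLOCK (v0.1 `E Corr Xl Yl dX`, caps, grid windows, RM-PB masses) WITHDRAWN as knit input (LEAD №20; instr1 FL-19/20′/21/22b: sign-blind pull-back
   masses grow like `L^{2m}`; the exact transported Wilson Hessian SATURATES, Σ_sg∕Ref ≈ 7.3 (loc) ∕ 12 (all) at κ = 0.5).  v0.2 (HOME d6ff083bae94f3cd) replaced it by LEAD №23's
   operator-norm clauses over ALL gauge-invariant test functionals `R` with a fine pair clause `(k, w)` and a fine GRADIENT sup-letter `g ≤ G`.  THIS EDITION (v0.3h) pins
   `R := h_Ts = log ρ_Ts − log ρ′_Ts` (inlined exactly as the organ's seed clause spells it) and DROPS the gradient letter, because (ideator №9): (i) instr1 FL-22b — first-order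
   joint rows in pointwise-letter currency have NO m-uniform constant, the extremiser being a gauge-invariant `R` aligned with the response field; the second-order `G`-term
   `DR[D²Φ[m,m′]]` admits the same alignment, so v0.2's `NG`, `δX·G`, `δL·G` are not m-uniform over the whole gauge-invariant class; (ii) the mechanism that makes the TRUE
   pull-back m-uniform is h-SPECIFIC — the marginal part `c·S_Ts` of `h_Ts` is critical on each fibre (Bałaban's variational problem, [Balaban1985Variational] (9)–(10)), so
   `DS_Ts[fibre direction] = 0` kills its gradient term, and the irrelevant part is small in every letter; an adversarial `R` has no such cancellation.  Hence ONE hoisted block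
   (H): `∀ k w, 0 ≤ w → w∕D_Ts ≤ w₀ → (k ≥ 0, row mass ≤ w) → FinePair[h_Ts; k] at (θBal_Ts∕4, rA∕2) → (JT-h) ∧ (L1ʲ-h) ∧ (L2ʲ-h)` with LIN′'s own input letters
   (`w₀` smallness included, as in LIN′ ws16) and OUTPUT masses `N•·Dr·w + δ• j·D_j` (`Dr := D_j∕D_Ts`, `D_i := (L^i∕γ)·θBal_i²`; `NT NX NL` constants, `δT δX δL` the frame's
   δ-triple) — so LIN′'s `(Ctr + εd)·x + δ j` closes with `Ctr ≥ NT + 2·NX + NL`, `δ ≥ δT + 2·δX + δL + tails`, NO `gT`, NO `G`: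
   (JT-h)  bracket `A` = `E_{Xw}[ΔΔF]`, INTEGRATED (v0.3i; v0.3h had it pointwise on a good set + (SQ) square stability — dropped: LIN′ supplies no sup-letter for `h_Ts`
           on the bad set, and an integrated clause docks on ✓R2b with no good/bad split): `∀ t ∈ [0,1], ∃ k′ ≥ 0`, row mass `≤ NT·Dr·w + δT j·D_j`, and for every coarse window square
           `U V W Y` (sizes `≤ rc·θ_j∕4`) and every law parameter `Xw` in the `θ_j∕4` window, `Integrable`×4 ∧ `|∫ (h_Ts(Φ(Y,z)) − h_Ts(Φ(V,z)) − h_Ts(Φ(W,z)) + h_Ts(Φ(U,z)))·ŵ_t(Xw,z) dτ|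
           ≤ k′ B B′·sz·sz′` (`Xw = Y` is ✓R2b's `E₁₁`; toy witness for `NT` at the marginal functional: FL-22b Σ_sg∕Ref ≈ 7.3∕12, m-uniform);
   (L1ʲ-h) brackets `L₁`/`L₂`: the MIXED second difference of `M(V₁, V₂) := ∫ h_Ts(Φ(V₁, z))·ŵ_t(V₂, z) dτ` (transport edge at `B` in the first argument, law edge at `B′` in the
           second; `Integrable`×4 as conjuncts of the conclusion, v0.3k) `≤ kX B B′·sz·sz′`, ROW and COLUMN masses `≤ NX·Dr·w + δX j·D_j`, for every `t ∈ [0,1]`;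
   (L2ʲ-h) bracket `L₀`: ✓(L2)'s square binder shape with the test function `h_Ts ∘ Φ(V₀₀, ·)` frozen at the base corner, `≤ kL B B′·sz·sz′`, row mass `≤ NL·Dr·w + δL j·D_j`, `∀ t`.
   (D-1, LEAD №27) m-UNIFORMITY OF `NT` FOR THIS `h` rests on (α) CURVATURE-form second-order transport — the clause constrains the TRUE coarse pair letters of the
   composite `h_Ts ∘ Φ` integrated against the fibre law, from LIN′'s infinitesimal fine pair clause of the gauge-invariant `h_Ts` (instr1 FL-23, free toy: curvature-indexed
   `N_T ≤ 8.8`, exact Wilson `7.3`; the link-indexed sign-blind composition `∝ L^{2m}` is a PROOF METHOD the text does not prescribe — desk RULING №71 (2)(ii): this clause is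
   «curvature-indexed» in that sense, and it carries NO first-order∕gradient-transport channel at all, (2)(i)) AND (β) the h-specific FIRST-order structure — criticality of the
   marginal part on every fibre [Balaban1985Variational (9)–(10)] and letter-smallness of the irrelevant part [Balaban1987RG1 (0.22)–(0.30)]; (β) has NO toy witness (the
   abelianised lift has `∇²Φ ≡ 0`) — residual «TN-JT-GRAD» is the DISCHARGER's.  Expected discharge route (LEAD №26 (W1), superseded as a FRAME item): big-window pointwise
   pull-back letters on `supp ŵ` [Balaban1987RG1 (0.22)–(0.25): localized analytic pieces on the full window] + square stability ⇒ the integral, no bad set.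
   (D-2, LEAD №27) NO toy witness for `NX NL` yet (instr1 FL-22 j342852 pending); (L2)-type responses VANISH identically in the free toy, so `NL`, `δL` are unpriced.
   (D-3, instr1 g14 census 05:04:39Z, FL-24 j342885) `NT = NT(κ)` is κ-DEPENDENT and ↑ ∞ as `κ → 0⁺` (the coherent gauge-invariant Hessian `½⟨K_B,·⟩²` transports with
   `≥ 1.4·L^{2m}` at `κ = 0`); the text binds `NT NX NL` AFTER `κ`, as it must.  `NX = NL = 0` identically in the free toy (rigid law), so (L1ʲ-h)∕(L2ʲ-h) are unpriced
   beyond the `O(g²)`·K-kernel structure.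
   (INT-CONCL, LEAD №29, v0.3k) ✓R2b's brackets are OFF-DIAGONAL (integrand at one corner, law of another), and LIN′ carries no sup-letter for `h_Ts`; so the
   integrability of `z ↦ h_Ts(Φ(V,z))·ŵ(X,z)` for corners `V ≠ X` of one square is the DISCHARGER's (square stability keeps `Φ(V,z)` in the `θ_Ts∕4` window on
   `supp ŵ(X,·)` for `rc` small; `h_Ts` is continuous there) — hence the four `Integrable` conjuncts now sit in the CONCLUSION of each (H) clause.
   What is LOST vs v0.2: generality over `R` (px5's JVAR/JEN knits test OTHER functionals — they are served by the law half's generic (L0)(L1)(L2)(L21)(L22) clauses, unchanged).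
   What is GAINED: no false-by-alignment quantifier, no gradient currency, a toy-printable `NT`, and the exact docking numbers LIN′ needs.
 • LAW HALF (px5's JVAR/JEN consumers; LIN no longer sees a covariance, LEAD №23 (D4)): (S) `TailClause` at `θBal_Ts∕8` with the FLOOR⁴ profile `ηin`; (L0) `CovClause`,
   (L1) `Resp1Clause`, (L2) `Resp2Clause`, (L21)/(L22) `Cum2Resp1Clause`/`Cum2Resp2Clause` UNCHANGED as clause texts (ambient test functions, `L2Row` letters,
   `Integrable` binders, `∀ t ∈ [0,1]` interpolated weights), their kernels now bounded by PROFILE LETTERS instead of κ-row-masses (instr1 (R1)/(T3): massless fibre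
   covariance has no m-uniform row mass in level-`Ts` units): `D a c ≤ ND·(1 + tdist_Ts(a,c))⁻¹·e^{−κ·tdist_j(π a, π c)}`, `R₁ c B ≤ N1·e^{−κ·tdist_j(π c, B)}`,
   `R₂ c B B′ ≤ N2·e^{−κ tdist_j(π c, B)}·e^{−κ tdist_j(π c, B′)}`, `R₂₁ a c B ≤ N21·core(a,c)·e^{−κ tdist_j(π c, B)}`, `R₂₂ a c B B′ ≤ N22·core(a,c)·e^{…B}·e^{…B′}` —
   sup-type constants (TRUE-able); LEAD №23 (D5): tradeable for δ-profiles on px5's word.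
LOCATE (docstrings only; nothing of print is formalised here): [Balaban1985Variational] Thm 1 p.279 / Prop 9 p.309 ((9)–(10): the minimiser's action identity — the
marginal's exact transport), [Balaban1984PropagatorsI] Prop 1.2, [Balaban1985PropagatorsII] (1.33), [Balaban1987RG1] Thm 1 / Thm 3 / (0.22) / (0.30) («gauge-invariant
functionals see only curvature», B11/B12), [HelfferSjostrand1994] [BrascampLieb1976] [NaddafSpencer1997] [Kunsch1982].
HONEST: typing draft; every clause is a HYPOTHESIS shape about Bałaban's minimisers / fibre laws, none discharged; `NT NG δX δL` unprinted beyond toy estimates;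
LIN′ / JEN′ / JVARᵘ-H / O1ᵘ-H v2.1 / S1aᴴ / 26243 / S2α′ / S2β OPEN; 20520 / `YM3TorusSU2` NOT proved; registry №36 `Lines/semiclassical_s2beta.lean` untouched; the v18.1
line file's only sorries are the five registered stubs; R3 = SU(2) YM₃ on T³ — NOT d = 4, NOT infinite volume, NOT a mass gap, NOT Clay; the Yang–Mills mass gap is NOT proved.
-/

set_option autoImplicit false

noncomputable section

namespace Summit.QuantumFields.YangMills.Cruxes.FluctuationComparisonRegPrIntL.FibreLawH

open MeasureTheory Filter Topology Function
open scoped ENNReal NNReal BigOperators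
open Literature.MathematicalPhysics.QuantumFieldTheory.Balaban1983to89 T3ContinuumYM3Torus T3NestedUnitLaws
  T3UnitLawDensityEML T4Continuum BalabanUVClass T3UnitScaleTilt T3LevelShift T3TiltDescent
open T4CubeChartExp (expPt)

/-! ## §1 The weights `ŵ_t` -/

/-- `χ_{j,Ts}(U)` — the multi-window soft cut of the stride `(j, Ts)` read on the fine field (LINᵘ-H / LEAD draft spelling, product of
`sfCut (θBal (j+1+i)) ∘ descendTo (j+1+i) Ts` over `i < Ts − j`; R-CUT-χ token `max 0 (min 1 ((24∕25·θ − dist1)∕((24∕25 − 1∕2)·θ)))`). -/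
def mwCut (F : T3Family) (γ b₀ p₀ : ℝ) (j Ts : ℕ) (U : GaugeField (F.P Ts) 0 ↥(Matrix.specialUnitaryGroup (Fin 2) ℂ)) : ℝ :=
  ∏ i ∈ Finset.range (Ts - j), (if h : j + 1 + i ≤ Ts then (∏ p : Plaq (F.P (j + 1 + i)) 0, max 0 (min 1 ((24 / 25 * θBal F.L γ b₀ p₀ (j + 1 + i)
    - dist1 (GaugeField.plaqHol (descendTo F ℰp (j + 1 + i) Ts h U) p)) / ((24 / 25 - 1 / 2) * θBal F.L γ b₀ p₀ (j + 1 + i))))) else 1)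

/-- Numerator of the interpolated fibre weight: `χ_{j,Ts}(Φ(V,z))·ρ_{Ts}(Φ(V,z))^t·ρ′_{Ts}(Φ(V,z))^{1−t}·J(V,z)` (`t = 0`: LIN's `χ·ρ′·J`). -/
def wNum (F : T3Family) (γ b₀ p₀ : ℝ) (j Ts : ℕ)
    (ρ ρ' : (i : ℕ) → GaugeField (F.P i) 0 ↥(Matrix.specialUnitaryGroup (Fin 2) ℂ) → ℝ) {Z : Type}
    (Φ : GaugeField (F.P j) 0 ↥(Matrix.specialUnitaryGroup (Fin 2) ℂ) × Z → GaugeField (F.P Ts) 0 ↥(Matrix.specialUnitaryGroup (Fin 2) ℂ))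
    (J : GaugeField (F.P j) 0 ↥(Matrix.specialUnitaryGroup (Fin 2) ℂ) × Z → NNReal) (t : ℝ)
    (V : GaugeField (F.P j) 0 ↥(Matrix.specialUnitaryGroup (Fin 2) ℂ)) (z : Z) : ℝ :=
  mwCut F γ b₀ p₀ j Ts (Φ (V, z)) * (Real.rpow (ρ Ts (Φ (V, z))) t * Real.rpow (ρ' Ts (Φ (V, z))) (1 - t)) * (J (V, z) : ℝ)

/-- The normalised interpolated fibre weight `ŵ_t(V, z) := wNum ∕ ∫ wNum dτ` (the fibre LAW over `V` as a density w.r.t. `τ`). -/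
def wgt (F : T3Family) (γ b₀ p₀ : ℝ) (j Ts : ℕ)
    (ρ ρ' : (i : ℕ) → GaugeField (F.P i) 0 ↥(Matrix.specialUnitaryGroup (Fin 2) ℂ) → ℝ) {Z : Type} [MeasurableSpace Z] (τ : Measure Z)
    (Φ : GaugeField (F.P j) 0 ↥(Matrix.specialUnitaryGroup (Fin 2) ℂ) × Z → GaugeField (F.P Ts) 0 ↥(Matrix.specialUnitaryGroup (Fin 2) ℂ))
    (J : GaugeField (F.P j) 0 ↥(Matrix.specialUnitaryGroup (Fin 2) ℂ) × Z → NNReal) (t : ℝ)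
    (V : GaugeField (F.P j) 0 ↥(Matrix.specialUnitaryGroup (Fin 2) ℂ)) (z : Z) : ℝ :=
  wNum F γ b₀ p₀ j Ts ρ ρ' Φ J t V z / (∫ z', wNum F γ b₀ p₀ j Ts ρ ρ' Φ J t V z' ∂τ)

/-! ## §3 The row -/

/-- «SPREAD-FIBRE-LAW-H» v0.3m — FROZEN LIN EDITION (= v0.3k def text with the law-half conjuncts [13]–[23] and the head letters `rF ND N1 N2 N21 N22 ηin` excised; INT-CONCL: the 12 `Integrable` binders of (H) are conjuncts of the conclusions) — chart block of `descendTo F ℰp j Ts` with a block projection `π`, ∧ (H) = JOINT-TRANSPORT-H (JT-h) ∧ JOINT-RESPONSE-H (L1ʲ-h)(L2ʲ-h) for the pinned test functional `h_Ts = log ρ_Ts − log ρ′_Ts`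
(module docstring). XL; NOT PRINTED as a theorem; a HYPOTHESIS row of the v18 H-line (feeds LEAD's LIN knit = w5 ✓`abs_fibreMean_secondDiff_le_response` brackets `A L₁ L₂ L₀`; the Jensen side reads the superset row `SpreadFibreLawHJ`; nothing in `Lines/` keys it).
Shapes after [Balaban1985Variational] Thm 1 p.279 ∕ Prop 9 p.309, [Balaban1987RG1] Thm 1 ∕ (0.22)–(0.30), [Balaban1985Averaging] (10)–(13) — SOURCES of the shapes only, nothing asserted. -/
def SpreadFibreLawH : Prop :=
  ∃ pW : ℝ, ∃ γ₁ : ℝ, 0 < γ₁ ∧ ∀ (F : T3Family) (γ : ℝ), 0 < γ → γ ≤ γ₁ → ∀ (b₀ p₀ : ℝ) (j₀ : ℕ) (prm : ℕ → ClassParams) (η : ℕ → ℝ) (rA : ℝ) (Bρ : ℕ → ℝ), 0 < b₀ → 0 < p₀ → pW ≤ p₀ → AdmissibleClassParams F γ b₀ p₀ prm → (∀ j, 0 ≤ η j) → Summable η → Summable (fun i => ∑' k, η (k + i)) → Tendsto (fun j => (∑' k, η (k + j)) * ((1 + 2 * ((F.L : ℝ) ^ j / γ) * (Fintype.card (Plaq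 (F.P j) 0) : ℝ)) * (Fintype.card (PBond (F.P j) 0) : ℝ) ^ 2)) atTop (𝓝 0) → 0 < rA → ∃ κ₀ : ℝ, 0 < κ₀ ∧ ∀ (κ : ℝ), 0 < κ → κ ≤ κ₀ → ∃ (rc w₀ NT NX NL CJ : ℝ) (δT δX δL : ℕ → ℝ) (j₁ : ℕ), 0 < rc ∧ 0 < w₀ ∧ 0 ≤ NT ∧ 0 ≤ NX ∧ 0 ≤ NL ∧ 0 ≤ CJ ∧ (∀ n, 0 ≤ δT n ∧ 0 ≤ δX n ∧ 0 ≤ δL n) ∧ Summable δT ∧ Summable (fun i => ∑' k, δT (k + i)) ∧ Tendsto (fun j => (∑' k, δT (k + j)) * ((1 + 2 * ((F.L : ℝ) ^ j / γ) * (Fintype.card (Plaq (F.P j) 0) : ℝ)) * (Fintype.card (PBond (F.P j) 0) : ℝ) ^ 2)) atTop (𝓝 0) ∧ Summable δX ∧ Summable (fun i => ∑' k, δX (k + i)) ∧ Tendsto (fun j => (∑' k, δX (k + j)) * ((1 + 2 * ((F.L : ℝ) ^ j / γ) * (Fintype.card (Plaq (F.P j) 0) : ℝ)) * (Fintype.card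 (PBond (F.P j) 0) : ℝ) ^ 2)) atTop (𝓝 0) ∧ Summable δL ∧ Summable (fun i => ∑' k, δL (k + i)) ∧ Tendsto (fun j => (∑' k, δL (k + j)) * ((1 + 2 * ((F.L : ℝ) ^ j / γ) * (Fintype.card (Plaq (F.P j) 0) : ℝ)) * (Fintype.card (PBond (F.P j) 0) : ℝ) ^ 2)) atTop (𝓝 0) ∧ j₀ ≤ j₁ ∧ ∀ (ν : ℕ → (j : ℕ) → MeasureTheory.Measure (GaugeField (F.P j) 0 ↥(Matrix.specialUnitaryGroup (Fin 2) ℂ))), (∀ K, ν K K = T4GenFunBounds.gibbsMeasure (F.P K) ((F.scheme ℰp γ).β K)) → (∀ K j, j < K → ν K j = Measure.map (descend F ℰp j) (ν K (j + 1))) → ∀ (K K' : ℕ), K ≤ K' → ∀ (Ts T : ℕ), Ts < T → T ≤ K → ∀ (μ μ' : ((j : ℕ) → MeasureTheory.Measure (GaugeField (F.P j) 0 ↥(Matrix.specialUnitaryGroup (Fin 2) ℂ)))) (ρ ρ' : ((j : ℕ) → GaugeField (F.P j) 0 ↥(Matrix.specialUnitaryGroup (Fin 2) ℂ) → ℝ)),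 (∀ j : ℕ, Ts ≤ j → j ≤ T → μ j = ν K j ∧ μ' j = ν K' j) → (∀ j : ℕ, j < Ts → μ j = Measure.map (descend F ℰp j) ((μ (j + 1)).withDensity (fun U => ENNReal.ofReal ((∏ p : Plaq _ _, max 0 (min 1 ((24 / 25 * (θBal F.L γ b₀ p₀ (j + 1)) - dist1 (GaugeField.plaqHol U p)) / ((24 / 25 - 1 / 2) * (θBal F.L γ b₀ p₀ (j + 1))))))))) ∧ μ' j = Measure.map (descend F ℰp j) ((μ' (j + 1)).withDensity (fun U => ENNReal.ofReal ((∏ p : Plaq _ _, max 0 (min 1 ((24 / 25 * (θBal F.L γ b₀ p₀ (j + 1)) - dist1 (GaugeField.plaqHol U p)) / ((24 / 25 - 1 / 2) * (θBal F.L γ b₀ p₀ (j + 1)))))))))) → (∀ j : ℕ, Ts ≤ j → j < T → μ j = Measure.map (descend F ℰp j) (μ (j + 1)) ∧ μ' j = Measure.map (descend F ℰp j) (μ' (j + 1))) → (∀ j : ℕ, j ≤ T → IsFiniteMeasure (μ j) ∧ IsFiniteMeasure (μ' j)) → (∀ j : ℕ, j₀ ≤ j → j ≤ T → ((∀ U,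 PlaqSmall (θBal F.L γ b₀ p₀ j) U → 0 < ρ j U ∧ 0 < ρ' j U) ∧ μ j = (fieldMeasure _ _ _).withDensity (fun U => ENNReal.ofReal (ρ j U)) ∧ μ' j = (fieldMeasure _ _ _).withDensity (fun U => ENNReal.ofReal (ρ' j U)) ∧ (∃ κ : ℝ, MemAtHeight F ℰp j (prm j) (fun U => Real.exp κ * ρ j U)) ∧ (∃ κ : ℝ, MemAtHeight F ℰp j (prm j) (fun U => Real.exp κ * ρ' j U)) ∧ μ j {U | ¬ PlaqSmall (θBal F.L γ b₀ p₀ j) U} ≤ ENNReal.ofReal (η j) ∧ μ' j {U | ¬ PlaqSmall (θBal F.L γ b₀ p₀ j) U} ≤ ENNReal.ofReal (η j) ∧ (ContinuousOn (ρ j) {U | PlaqSmall (θBal F.L γ b₀ p₀ j) U} ∧ ContinuousOn (ρ' j) {U | PlaqSmall (θBal F.L γ b₀ p₀ j) U}) ∧ ((∀ (U : GaugeField _ _ ↥(Matrix.specialUnitaryGroup (Fin 2) ℂ)), PlaqSmall (49 / 50 * θBal F.L γ b₀ p₀ j) U → ∀ (b b' : PBond _ _) (v v' : Fin 3 → ℝ),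 ‖v‖ ≤ 1 → ‖v'‖ ≤ 1 → ∃ g : ℂ × ℂ → ℂ, DifferentiableOn ℂ g (Metric.ball (0 : ℂ) (rA * (49 / 50 * θBal F.L γ b₀ p₀ j)) ×ˢ Metric.ball (0 : ℂ) (rA * (49 / 50 * θBal F.L γ b₀ p₀ j))) ∧ (∀ (s t : ℝ) (V Z : GaugeField _ _ ↥(Matrix.specialUnitaryGroup (Fin 2) ℂ)), |s| < rA * (49 / 50 * θBal F.L γ b₀ p₀ j) → |t| < rA * (49 / 50 * θBal F.L γ b₀ p₀ j) → (∀ e, e ≠ b → V e = U e) → V b = U b * expPt (s • v) → (∀ e, e ≠ b' → Z e = V e) → Z b' = V b' * expPt (t • v') → g ((s : ℂ), (t : ℂ)) = (((Real.log (ρ j Z)) : ℝ) : ℂ)) ∧ ∀ z ∈ Metric.ball (0 : ℂ) (rA * (49 / 50 * θBal F.L γ b₀ p₀ j)) ×ˢ Metric.ball (0 : ℂ) (rA * (49 / 50 * θBal F.L γ b₀ p₀ j)), ‖g z - g 0‖ ≤ (Bρ j)) ∧ (∀ (U : GaugeField _ _ ↥(Matrix.specialUnitaryGroup (Fin 2)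 ℂ)), PlaqSmall (49 / 50 * θBal F.L γ b₀ p₀ j) U → ∀ (b b' : PBond _ _) (v v' : Fin 3 → ℝ), ‖v‖ ≤ 1 → ‖v'‖ ≤ 1 → ∃ g : ℂ × ℂ → ℂ, DifferentiableOn ℂ g (Metric.ball (0 : ℂ) (rA * (49 / 50 * θBal F.L γ b₀ p₀ j)) ×ˢ Metric.ball (0 : ℂ) (rA * (49 / 50 * θBal F.L γ b₀ p₀ j))) ∧ (∀ (s t : ℝ) (V Z : GaugeField _ _ ↥(Matrix.specialUnitaryGroup (Fin 2) ℂ)), |s| < rA * (49 / 50 * θBal F.L γ b₀ p₀ j) → |t| < rA * (49 / 50 * θBal F.L γ b₀ p₀ j) → (∀ e, e ≠ b → V e = U e) → V b = U b * expPt (s • v) → (∀ e, e ≠ b' → Z e = V e) → Z b' = V b' * expPt (t • v') → g ((s : ℂ), (t : ℂ)) = (((Real.log (ρ' j Z)) : ℝ) : ℂ)) ∧ ∀ z ∈ Metric.ball (0 : ℂ) (rA * (49 / 50 * θBal F.L γ b₀ p₀ j)) ×ˢ Metric.ball (0 : ℂ) (rA * (49 / 50 * θBal F.L γ b₀ p₀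 j)), ‖g z - g 0‖ ≤ (Bρ j))))) → ∀ (j : ℕ), j₁ ≤ j → ∀ (hjTs : j + 1 ≤ Ts), ∃ (Z : Type) (_ : MeasurableSpace Z) (τ : MeasureTheory.Measure Z) (Φ : GaugeField (F.P j) 0 ↥(Matrix.specialUnitaryGroup (Fin 2) ℂ) × Z → GaugeField (F.P Ts) 0 ↥(Matrix.specialUnitaryGroup (Fin 2) ℂ)) (J : GaugeField (F.P j) 0 ↥(Matrix.specialUnitaryGroup (Fin 2) ℂ) × Z → NNReal) (S : Set (GaugeField (F.P Ts) 0 ↥(Matrix.specialUnitaryGroup (Fin 2) ℂ))) (π : Site (F.P Ts) 0 → Site (F.P j) 0), MeasureTheory.IsProbabilityMeasure τ ∧ Measurable Φ ∧ Measurable J ∧ MeasurableSet S ∧ (∀ U : GaugeField (F.P Ts) 0 ↥(Matrix.specialUnitaryGroup (Fin 2) ℂ), (∀ (n : ℕ) (hjn : j + 1 ≤ n) (hnK : n ≤ Ts), PlaqSmall (24 / 25 * θBal F.L γ b₀ p₀ n) (descendTo F ℰp n Ts hnK U)) → U ∈ S) ∧ (∀ V z, descendTo F ℰp j Ts (Nat.le_of_succ_le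 hjTs) (Φ (V, z)) = V) ∧ (∀ A : Set (GaugeField (F.P j) 0 ↥(Matrix.specialUnitaryGroup (Fin 2) ℂ)), MeasurableSet A → (fieldMeasure (F.P Ts) 0 ↥(Matrix.specialUnitaryGroup (Fin 2) ℂ)).restrict (descendTo F ℰp j Ts (Nat.le_of_succ_le hjTs) ⁻¹' A ∩ S) = ((((fieldMeasure (F.P j) 0 ↥(Matrix.specialUnitaryGroup (Fin 2) ℂ)).restrict A).prod τ).withDensity (fun p => (J p : ENNReal))).map Φ) ∧ (∀ f : GaugeField (F.P Ts) 0 ↥(Matrix.specialUnitaryGroup (Fin 2) ℂ) → ℝ, Continuous f → (∀ U, f U ≠ 0 → (∀ (n : ℕ) (hjn : j + 1 ≤ n) (hnK : n ≤ Ts), PlaqSmall (24 / 25 * θBal F.L γ b₀ p₀ n) (descendTo F ℰp n Ts hnK U))) → ∀ z, ContinuousOn (fun V => (J (V, z) : ℝ) * f (Φ (V, z))) {V | PlaqSmall (θBal F.L γ b₀ p₀ j) V}) ∧ (∀ V z, (J (V, z) : ℝ) ≤ CJ) ∧ (∀ V, PlaqSmall (θBal F.L γ b₀ p₀ j) V →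 0 < ∫⁻ z in {z | (∀ (n : ℕ) (hjn : j + 1 ≤ n) (hnK : n ≤ Ts), PlaqSmall (24 / 25 * θBal F.L γ b₀ p₀ n) (descendTo F ℰp n Ts hnK (Φ (V, z))))}, (J (V, z) : ENNReal) ∂τ) ∧ (∀ x y : Site (F.P Ts) 0, (((π x).tdist (π y) : ℕ) : ℝ) ≤ ((x.tdist y : ℕ) : ℝ)) ∧ (∀ y : Site (F.P j) 0, ∃ s : Finset (Site (F.P Ts) 0), (∀ x, π x = y → x ∈ s) ∧ (s.card : ℝ) ≤ ((F.L : ℝ) ^ (Ts - j)) ^ 3) ∧ (∀ (k : PBond (F.P Ts) 0 → PBond (F.P Ts) 0 → ℝ) (w : ℝ), 0 ≤ w → w / (((F.L : ℝ) ^ Ts / γ) * θBal F.L γ b₀ p₀ Ts ^ 2) ≤ w₀ → (∀ b b', 0 ≤ k b b') → (∀ b, ∑ b', k b b' * Real.exp (κ * (b.src.tdist b'.src : ℝ)) ≤ w) → (∀ (b b' : PBond (F.P Ts) 0) (v v' : Fin 3 → ℝ) (U V W Y : GaugeField (F.P Ts) 0 ↥(Matrix.specialUnitaryGroup (Fin 2)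 ℂ)), ‖v‖ ≤ (rA / 2) * (θBal F.L γ b₀ p₀ Ts / 4) → ‖v'‖ ≤ (rA / 2) * (θBal F.L γ b₀ p₀ Ts / 4) → PlaqSmall (θBal F.L γ b₀ p₀ Ts / 4) U → PlaqSmall (θBal F.L γ b₀ p₀ Ts / 4) V → PlaqSmall (θBal F.L γ b₀ p₀ Ts / 4) W → PlaqSmall (θBal F.L γ b₀ p₀ Ts / 4) Y → (∀ e, e ≠ b → V e = U e) → V b = U b * expPt v → (∀ e, e ≠ b' → W e = U e) → W b' = U b' * expPt v' → (∀ e, e ≠ b' → Y e = V e) → Y b' = V b' * expPt v' → |(Real.log (ρ Ts Y) - Real.log (ρ' Ts Y)) - (Real.log (ρ Ts V) - Real.log (ρ' Ts V)) - (Real.log (ρ Ts W) - Real.log (ρ' Ts W)) + (Real.log (ρ Ts U) - Real.log (ρ' Ts U))| ≤ k b b' * (‖v‖ / (θBal F.L γ b₀ p₀ Ts / 4)) * (‖v'‖ / (θBal F.L γ b₀ p₀ Ts / 4))) → (∀ t : ℝ, 0 ≤ t → t ≤ 1 → ∃ k' : PBond (F.P j) 0 → PBond (F.P j) 0 → ℝ,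 (∀ B B', 0 ≤ k' B B') ∧ (∀ B, ∑ B', k' B B' * Real.exp (κ * (B.src.tdist B'.src : ℝ)) ≤ NT * ((((F.L : ℝ) ^ j / γ) * θBal F.L γ b₀ p₀ j ^ 2) / (((F.L : ℝ) ^ Ts / γ) * θBal F.L γ b₀ p₀ Ts ^ 2)) * w + δT j * (((F.L : ℝ) ^ j / γ) * θBal F.L γ b₀ p₀ j ^ 2)) ∧ (∀ (B B' : PBond (F.P j) 0) (m m' : Fin 3 → ℝ) (U V W Y Xw : GaugeField (F.P j) 0 ↥(Matrix.specialUnitaryGroup (Fin 2) ℂ)), ‖m‖ ≤ rc * (θBal F.L γ b₀ p₀ j / 4) → ‖m'‖ ≤ rc * (θBal F.L γ b₀ p₀ j / 4) → PlaqSmall (θBal F.L γ b₀ p₀ j / 4) U → PlaqSmall (θBal F.L γ b₀ p₀ j / 4) V → PlaqSmall (θBal F.L γ b₀ p₀ j / 4) W → PlaqSmall (θBal F.L γ b₀ p₀ j / 4) Y → PlaqSmall (θBal F.L γ b₀ p₀ j / 4) Xw → (∀ e, e ≠ B → V e = U e) → V B = U B * expPt m → (∀ e, e ≠ B' → W e =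 U e) → W B' = U B' * expPt m' → (∀ e, e ≠ B' → Y e = V e) → Y B' = V B' * expPt m' → Integrable (fun z => (Real.log (ρ Ts (Φ (U, z))) - Real.log (ρ' Ts (Φ (U, z)))) * (wgt F γ b₀ p₀ j Ts ρ ρ' τ Φ J t) Xw z) τ ∧ Integrable (fun z => (Real.log (ρ Ts (Φ (V, z))) - Real.log (ρ' Ts (Φ (V, z)))) * (wgt F γ b₀ p₀ j Ts ρ ρ' τ Φ J t) Xw z) τ ∧ Integrable (fun z => (Real.log (ρ Ts (Φ (W, z))) - Real.log (ρ' Ts (Φ (W, z)))) * (wgt F γ b₀ p₀ j Ts ρ ρ' τ Φ J t) Xw z) τ ∧ Integrable (fun z => (Real.log (ρ Ts (Φ (Y, z))) - Real.log (ρ' Ts (Φ (Y, z)))) * (wgt F γ b₀ p₀ j Ts ρ ρ' τ Φ J t) Xw z) τ ∧ |∫ z, ((Real.log (ρ Ts (Φ (Y, z))) - Real.log (ρ' Ts (Φ (Y, z)))) - (Real.log (ρ Ts (Φ (V, z))) - Real.log (ρ' Ts (Φ (V, z)))) - (Real.log (ρ Ts (Φ (W, z))) - Real.log (ρ' Ts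 (Φ (W, z)))) + (Real.log (ρ Ts (Φ (U, z))) - Real.log (ρ' Ts (Φ (U, z))))) * (wgt F γ b₀ p₀ j Ts ρ ρ' τ Φ J t) Xw z ∂τ| ≤ k' B B' * (‖m‖ / (θBal F.L γ b₀ p₀ j / 4)) * (‖m'‖ / (θBal F.L γ b₀ p₀ j / 4)))) ∧ (∀ t : ℝ, 0 ≤ t → t ≤ 1 → ∃ kX : PBond (F.P j) 0 → PBond (F.P j) 0 → ℝ, (∀ B B', 0 ≤ kX B B') ∧ (∀ B, ∑ B', kX B B' * Real.exp (κ * (B.src.tdist B'.src : ℝ)) ≤ NX * ((((F.L : ℝ) ^ j / γ) * θBal F.L γ b₀ p₀ j ^ 2) / (((F.L : ℝ) ^ Ts / γ) * θBal F.L γ b₀ p₀ Ts ^ 2)) * w + δX j * (((F.L : ℝ) ^ j / γ) * θBal F.L γ b₀ p₀ j ^ 2)) ∧ (∀ B', ∑ B, kX B B' * Real.exp (κ * (B.src.tdist B'.src : ℝ)) ≤ NX * ((((F.L : ℝ) ^ j / γ) * θBal F.L γ b₀ p₀ j ^ 2) / (((F.L : ℝ) ^ Ts / γ) * θBal F.L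 γ b₀ p₀ Ts ^ 2)) * w + δX j * (((F.L : ℝ) ^ j / γ) * θBal F.L γ b₀ p₀ j ^ 2)) ∧ (∀ (B B' : PBond (F.P j) 0) (m m' : Fin 3 → ℝ) (U₁ V₁ U₂ W₂ : GaugeField (F.P j) 0 ↥(Matrix.specialUnitaryGroup (Fin 2) ℂ)), ‖m‖ ≤ rc * (θBal F.L γ b₀ p₀ j / 4) → ‖m'‖ ≤ rc * (θBal F.L γ b₀ p₀ j / 4) → PlaqSmall (θBal F.L γ b₀ p₀ j / 4) U₁ → PlaqSmall (θBal F.L γ b₀ p₀ j / 4) V₁ → PlaqSmall (θBal F.L γ b₀ p₀ j / 4) U₂ → PlaqSmall (θBal F.L γ b₀ p₀ j / 4) W₂ → (∀ e, e ≠ B → V₁ e = U₁ e) → V₁ B = U₁ B * expPt m → (∀ e, e ≠ B' → W₂ e = U₂ e) → W₂ B' = U₂ B' * expPt m' → Integrable (fun z => (Real.log (ρ Ts (Φ (U₁, z))) - Real.log (ρ' Ts (Φ (U₁, z)))) * (wgt F γ b₀ p₀ j Ts ρ ρ' τ Φ J t) U₂ z) τ ∧ Integrable (fun z => (Real.log (ρ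 Ts (Φ (V₁, z))) - Real.log (ρ' Ts (Φ (V₁, z)))) * (wgt F γ b₀ p₀ j Ts ρ ρ' τ Φ J t) U₂ z) τ ∧ Integrable (fun z => (Real.log (ρ Ts (Φ (U₁, z))) - Real.log (ρ' Ts (Φ (U₁, z)))) * (wgt F γ b₀ p₀ j Ts ρ ρ' τ Φ J t) W₂ z) τ ∧ Integrable (fun z => (Real.log (ρ Ts (Φ (V₁, z))) - Real.log (ρ' Ts (Φ (V₁, z)))) * (wgt F γ b₀ p₀ j Ts ρ ρ' τ Φ J t) W₂ z) τ ∧ |((∫ z, (Real.log (ρ Ts (Φ (V₁, z))) - Real.log (ρ' Ts (Φ (V₁, z)))) * (wgt F γ b₀ p₀ j Ts ρ ρ' τ Φ J t) W₂ z ∂τ) - (∫ z, (Real.log (ρ Ts (Φ (U₁, z))) - Real.log (ρ' Ts (Φ (U₁, z)))) * (wgt F γ b₀ p₀ j Ts ρ ρ' τ Φ J t) W₂ z ∂τ)) - ((∫ z, (Real.log (ρ Ts (Φ (V₁, z))) - Real.log (ρ' Ts (Φ (V₁, z)))) * (wgt F γ b₀ p₀ j Ts ρ ρ' τ Φ J t)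 U₂ z ∂τ) - (∫ z, (Real.log (ρ Ts (Φ (U₁, z))) - Real.log (ρ' Ts (Φ (U₁, z)))) * (wgt F γ b₀ p₀ j Ts ρ ρ' τ Φ J t) U₂ z ∂τ))| ≤ kX B B' * (‖m‖ / (θBal F.L γ b₀ p₀ j / 4)) * (‖m'‖ / (θBal F.L γ b₀ p₀ j / 4)))) ∧ (∀ t : ℝ, 0 ≤ t → t ≤ 1 → ∃ kL : PBond (F.P j) 0 → PBond (F.P j) 0 → ℝ, (∀ B B', 0 ≤ kL B B') ∧ (∀ B, ∑ B', kL B B' * Real.exp (κ * (B.src.tdist B'.src : ℝ)) ≤ NL * ((((F.L : ℝ) ^ j / γ) * θBal F.L γ b₀ p₀ j ^ 2) / (((F.L : ℝ) ^ Ts / γ) * θBal F.L γ b₀ p₀ Ts ^ 2)) * w + δL j * (((F.L : ℝ) ^ j / γ) * θBal F.L γ b₀ p₀ j ^ 2)) ∧ (∀ (B B' : PBond (F.P j) 0) (m m' : Fin 3 → ℝ) (V00 V10 V01 V11 : GaugeField (F.P j) 0 ↥(Matrix.specialUnitaryGroup (Fin 2) ℂ)), ‖m‖ ≤ rc * (θBal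 F.L γ b₀ p₀ j / 4) → ‖m'‖ ≤ rc * (θBal F.L γ b₀ p₀ j / 4) → PlaqSmall (θBal F.L γ b₀ p₀ j / 4) V00 → PlaqSmall (θBal F.L γ b₀ p₀ j / 4) V10 → PlaqSmall (θBal F.L γ b₀ p₀ j / 4) V01 → PlaqSmall (θBal F.L γ b₀ p₀ j / 4) V11 → (∀ e, e ≠ B → V10 e = V00 e) → V10 B = V00 B * expPt m → (∀ e, e ≠ B' → V01 e = V00 e) → V01 B' = V00 B' * expPt m' → (∀ e, e ≠ B' → V11 e = V10 e) → V11 B' = V10 B' * expPt m' → Integrable (fun z => (Real.log (ρ Ts (Φ (V00, z))) - Real.log (ρ' Ts (Φ (V00, z)))) * (wgt F γ b₀ p₀ j Ts ρ ρ' τ Φ J t) V00 z) τ ∧ Integrable (fun z => (Real.log (ρ Ts (Φ (V00, z))) - Real.log (ρ' Ts (Φ (V00, z)))) * (wgt F γ b₀ p₀ j Ts ρ ρ' τ Φ J t) V10 z) τ ∧ Integrable (fun z => (Real.log (ρ Ts (Φ (V00, z))) - Real.log (ρ' Ts (Φ (V00, z)))) * (wgt F γ b₀ p₀ j Ts ρ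 ρ' τ Φ J t) V01 z) τ ∧ Integrable (fun z => (Real.log (ρ Ts (Φ (V00, z))) - Real.log (ρ' Ts (Φ (V00, z)))) * (wgt F γ b₀ p₀ j Ts ρ ρ' τ Φ J t) V11 z) τ ∧ |(∫ z, (Real.log (ρ Ts (Φ (V00, z))) - Real.log (ρ' Ts (Φ (V00, z)))) * (wgt F γ b₀ p₀ j Ts ρ ρ' τ Φ J t) V11 z ∂τ) - (∫ z, (Real.log (ρ Ts (Φ (V00, z))) - Real.log (ρ' Ts (Φ (V00, z)))) * (wgt F γ b₀ p₀ j Ts ρ ρ' τ Φ J t) V10 z ∂τ) - (∫ z, (Real.log (ρ Ts (Φ (V00, z))) - Real.log (ρ' Ts (Φ (V00, z)))) * (wgt F γ b₀ p₀ j Ts ρ ρ' τ Φ J t) V01 z ∂τ) + (∫ z, (Real.log (ρ Ts (Φ (V00, z))) - Real.log (ρ' Ts (Φ (V00, z)))) * (wgt F γ b₀ p₀ j Ts ρ ρ' τ Φ J t) V00 z ∂τ)| ≤ kL B B' * (‖m‖ / (θBal F.L γ b₀ p₀ j / 4)) * (‖m'‖ / (θBal F.L γ b₀ p₀ j / 4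)))))

end Summit.QuantumFields.YangMills.Cruxes.FluctuationComparisonRegPrIntL.FibreLawH

end
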